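import Summits.ABC.IUTFork.Joshi.TestIsmCriterion
import HarnessLib

/-!
# Block E — SCOPE of the index criterion in `l⋆`: the «proper sub-(Ind2) reaches S» phenomenon is an `l⋆ = 2` artefact

Record file (D-0012) of the abc-iut cell, block E (rung LADDER-ABC:A2.E; seat abc-iut-E-cx-3, THIRD block-E adversary; announced
2026-08-26T11:21:47Z). PROOF-ONLY (0 `def`), arithmetic of `ℤ` plus one restatement on the tree's `toyIndex`. TAKES NO SIDE; typed ≠ proved.

abc-iut-E-t58's index criterion (`IsmPartial.pilotKummerIndRelated_iff_sub_jsq_mem`, p440522): at the generic one-place line-shell model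
`ismSetting p I hI`, S = `Cor312Vol.PilotKummerIndRelated` ⟺ every gap `1 − j²` (`j ∈ 𝔽_l^⋆`) lies in `H(I) := AddSubgroup.closure (v_p '' scalars(I))`.
The tree's carriers have `l⋆ = 2` (`toyIndex`), where the gaps are `{0, −3}` — hence «S ⟺ 3 ∈ H(I)» (`criterion_toyIndex_iff` below) and the
PROPER sub-(Ind2) `cubes` (`H = 3ℤ ≠ ℤ`) reaching S (p440522 §5). THIS FILE pins the scope of that moral: for EVERY `l⋆ ≥ 3` the gap
condition forces `H = ℤ` (`gcd(2² − 1, 3² − 1) = gcd(3, 8) = 1`; `eq_top_of_gaps_mem`, `gaps_mem_iff_eq_top`), i.e. at non-toy sizes of `l`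
the located sentence reads «`⟨(Ind1) ∪ (Ind2)⟩` contains, at every label, a line rescaling of valuation exactly `1`» (a closure WORD acting as
`x ↦ u·p·x`; `I` itself may stay proper, e.g. scalars `p^{3a+8b}`) — E-plan's leg (ii) wording «REACHES S iff it GENERATES the gaps `1 − j²`»
(RESULT LINE 11:18:21Z) is `l`-robust; the cubes instance is to be quoted «on `toyIndex` (l⋆ = 2)». `toyIndex_gaps_not_top`: at `l⋆ = 2` the
gap condition does NOT force `H = ℤ` (witness `H = 3ℤ`). No carriers with `l⋆ ≥ 3` are typed in the tree, so the `l⋆ ≥ 3` half is pure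
arithmetic, stated over `ℤ`. [claim: Mochizuki2012, status: disputed] (the criterion's S-side); arithmetic [folklore].
-/

namespace Summit.ABC.IUTFork.Joshi.IsmPartial.Scope

open Thm311 Cor312 Cor312.Checks Cor312.IdentifiedNonVacuity Cor312Vol Cor312Vol.NaiveWitness Cor312Vol.PinnedWitness IsmScaling

/-! ## 1. `ℤ`-arithmetic: the gaps `1 − j²`, `1 ≤ j ≤ l⋆`, generate `ℤ` as soon as `l⋆ ≥ 3` -/

/-- `3 ∈ H ∧ 8 ∈ H ⟹ H = ℤ` (`1 = 3 + 3 + 3 − 8`). [folklore] -/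
theorem eq_top_of_three_mem_of_eight_mem {H : AddSubgroup ℤ} (h3 : (3 : ℤ) ∈ H) (h8 : (8 : ℤ) ∈ H) : H = ⊤ := by
  have h1 : (1 : ℤ) ∈ H := by
    have h9 : (9 : ℤ) ∈ H := by simpa using H.add_mem (H.add_mem h3 h3) h3
    simpa using H.sub_mem h9 h8
  exact (AddSubgroup.eq_top_iff' H).2 fun n => by simpa using H.zsmul_mem h1 n

/-- **For every `l⋆ ≥ 3`: if all gaps `1 − j²` (`1 ≤ j ≤ l⋆`) lie in `H`, then `H = ℤ`** (use `j = 2, 3`). [folklore] -/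
theorem eq_top_of_gaps_mem {H : AddSubgroup ℤ} {lstar : ℕ} (hl : 3 ≤ lstar)
    (h : ∀ j : ℕ, 1 ≤ j → j ≤ lstar → (1 - (j : ℤ) ^ 2) ∈ H) : H = ⊤ := by
  have h3 : (3 : ℤ) ∈ H := by simpa using H.neg_mem (h 2 (by norm_num) (by omega))
  have h8 : (8 : ℤ) ∈ H := by simpa using H.neg_mem (h 3 (by norm_num) hl)
  exact eq_top_of_three_mem_of_eight_mem h3 h8

/-- … and conversely every gap lies in `ℤ = ⊤`; so for `l⋆ ≥ 3` the gap condition IS `H = ℤ`. [folklore] -/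
theorem gaps_mem_iff_eq_top {H : AddSubgroup ℤ} {lstar : ℕ} (hl : 3 ≤ lstar) :
    (∀ j : ℕ, 1 ≤ j → j ≤ lstar → (1 - (j : ℤ) ^ 2) ∈ H) ↔ H = ⊤ :=
  ⟨eq_top_of_gaps_mem hl, fun hH _ _ _ => hH ▸ AddSubgroup.mem_top _⟩

/-- `H = ℤ` iff `1 ∈ H` (the Frobenius-size step is GENERATED). [folklore] -/
theorem eq_top_iff_one_mem {H : AddSubgroup ℤ} : H = ⊤ ↔ (1 : ℤ) ∈ H :=
  ⟨fun hH => hH ▸ AddSubgroup.mem_top _, fun h1 => (AddSubgroup.eq_top_iff' H).2 fun n => by simpa using H.zsmul_mem h1 n⟩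

/-! ## 2. The contrast at `l⋆ = 2` (the tree's `toyIndex`) -/

/-- At `l⋆ = 2` the gap condition is `3 ∈ H` … [folklore] -/
theorem gaps_two_iff {H : AddSubgroup ℤ} : (∀ j : ℕ, 1 ≤ j → j ≤ 2 → (1 - (j : ℤ) ^ 2) ∈ H) ↔ (3 : ℤ) ∈ H := by
  constructor
  · intro h
    simpa using H.neg_mem (h 2 (by norm_num) le_rfl)
  · intro h3 j hj1 hj2
    rcases (show j = 1 ∨ j = 2 by omega) with rfl | rfl
    · simp
    · simpa using H.neg_mem h3

/-- … which does NOT force `H = ℤ`: `H = 3ℤ` satisfies it and misses `1`. [folklore] -/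
theorem toyIndex_gaps_not_top :
    (∀ j : ℕ, 1 ≤ j → j ≤ 2 → (1 - (j : ℤ) ^ 2) ∈ AddSubgroup.zmultiples (3 : ℤ)) ∧ AddSubgroup.zmultiples (3 : ℤ) ≠ ⊤ := by
  refine ⟨gaps_two_iff.2 (AddSubgroup.mem_zmultiples _), fun htop => ?_⟩
  have h1 : (1 : ℤ) ∈ AddSubgroup.zmultiples (3 : ℤ) := htop ▸ AddSubgroup.mem_top _
  obtain ⟨k, hk⟩ := AddSubgroup.mem_zmultiples_iff.1 h1
  have hk' : k * 3 = 1 := by simpa using hk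
  omega

/-- **The criterion's right-hand side on the tree's `toyIndex`, in closed form:** `(∀ j ∈ 𝔽_l^⋆, 1 − j² ∈ G) ⟺ 3 ∈ G`
(labels `1, 2`; abc-iut-E-t58's `one_sub_jsq_eq`). [folklore] -/
theorem criterion_toyIndex_iff (G : AddSubgroup ℤ) :
    (∀ j : toyIndex.Label, j ≠ 0 → (1 - jsq j : ℤ) ∈ G) ↔ (3 : ℤ) ∈ G := by
  constructor
  · intro h
    have h2 := h (Setting.labelSucc ⟨1, by decide⟩) (Setting.labelSucc_ne_zero _)
    have h4 : jsq (Setting.labelSucc ⟨1, by decide⟩ : toyIndex.Label) = 4 := rfl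
    rw [h4] at h2
    simpa using G.neg_mem h2
  · intro h3 j hj
    rcases one_sub_jsq_eq hj with h0 | hm3
    · rw [h0]; exact G.zero_mem
    · rw [hm3]; simpa using G.neg_mem h3

/-- Hence, on `toyIndex`, **S at `ismSetting p I hI` ⟺ `3 ∈ H(I)`** (E-t58's criterion in closed form). [claim: Mochizuki2012, status: disputed] -/
theorem pilotKummerIndRelated_iff_three_mem (p : ℕ) [Fact p.Prime] (I : Set (ℚ ≃ₗ[ℚ] ℚ)) (hI : LinearEquiv.refl ℚ ℚ ∈ I) :
    Summit.ABC.IUTFork.Cor312Vol.PilotKummerIndRelated (ismFull p I hI).toLatticeSituation (ismSetting p I hI)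
        (IsmScaling.scalRegion p) (Cor312Vol.PinnedWitness.qDatum p) ↔
      (3 : ℤ) ∈ AddSubgroup.closure ((fun g : ℚ ≃ₗ[ℚ] ℚ => padicValRat p (g 1)) '' I) :=
  (pilotKummerIndRelated_iff_sub_jsq_mem p I hI).trans (criterion_toyIndex_iff _)

end Summit.ABC.IUTFork.Joshi.IsmPartial.Scope
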